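import Literature.Computability.QuantumComplexity.QFTQubitsPhases
import Literature.Computability.QuantumComplexity.QFTQubitsTensor
import HarnessLib

/-!
# The `n`-fold QFT with approximate gates: errors add over all rounds of all blocks

Topic `Literature/Computability/QuantumComplexity`, sequel of `QFTQubitsPhases.lean` (one register: the
ideal gate list `allGates ws` whose product is the QFT, and the robust form through `ImplOn.listProd`)
and `QFTQubitsTensor.lean` (`multiQFT S`, the product of the one-block transforms of `n` disjoint
blocks). The Fourier stage of Regev's quantum sampler (Regev 2009, Lemma 3.14) applies the one-block
circuit — Hadamards and, for the controlled phases, Clifford+`T` gadgets each IMPLEMENTING its ideal gate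
on a clean-ancilla support up to a dyadic rounding error — to the `n` coefficient registers one after
the other. At the operator level no product-state reasoning is needed: listing the steps of all blocks
(block `0` applied first), **`implOn_multiQFT_of_blocks`** — the product of the actual steps implements
`multiQFT S` on the support up to the sum of all the errors (`ImplOn.listProd`, `prod_allGates`).

Everything here is proved; no definition, no named fact.

## References

* M. A. Nielsen, I. L. Chuang, *Quantum Computation and Quantum Information*, CUP 2010, §4.5.3
  eq. (4.63), §5.1 [NielsenChuang2010].
* O. Regev, *On lattices, learning with errors, random linear codes, and cryptography*, J. ACM 56
  (2009), art. 34, Lemma 3.14 (proof) [Regev2009].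
-/

noncomputable section

namespace Literature.Computability.QuantumComplexity

open _root_.Matrix Finset Cryptography QFTQubits

variable {N κ n : ℕ}

/-- The ideal side: the concatenated gate lists of the blocks (last block first) multiply to `multiQFT`.
[cite: NielsenChuang2010, §5.1] -/
theorem prod_flatten_allGates (S : Fin n → (Fin κ ↪ Fin N)) :
    ((List.ofFn fun i : Fin n => allGates (S i)).reverse.flatten).prod = multiQFT S := by
  rw [List.prod_flatten, List.map_reverse, List.map_ofFn, multiQFT]
  congr 2
  exact List.ofFn_inj.2 (funext fun i => by rw [Function.comp_apply, prod_allGates]; rfl)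

/-- **The `n`-fold QFT with approximate gates.** For disjoint... (no disjointness needed here) blocks
`S i`, a support condition `P` closed under rewriting every wire of every block, and for each block a
list of steps whose ideal matrices are `allGates (S i)` (in order), each actual matrix a contraction
implementing its ideal gate on `P` up to a nonnegative error: the product of all actual steps (the
blocks in the order `0, …, n−1`, i.e. listed last block first) implements `multiQFT S` on `P` up to the
sum of all the errors. [cite: NielsenChuang2010, §4.5.3 eq. (4.63)] [cite: Regev2009, Lemma 3.14 (proof)] -/
theorem implOn_multiQFT_of_blocks (S : Fin n → (Fin κ ↪ Fin N)) {P : Set (QReg N)}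
    (hP : ∀ (i : Fin n) (j : Fin κ) (x : QReg N) (b : Bool), Function.update x (S i j) b ∈ P ↔ x ∈ P)
    (L : Fin n → List (ApproxStep N)) (hL : ∀ i, (L i).map ApproxStep.ideal = allGates (S i))
    (himpl : ∀ i, ∀ s ∈ L i, ImplOn P s.act s.ideal s.err) (hcontr : ∀ i, ∀ s ∈ L i, IsContraction s.act)
    (herr : ∀ i, ∀ s ∈ L i, 0 ≤ s.err) :
    ImplOn P (((List.ofFn L).reverse.flatten).map ApproxStep.act).prod (multiQFT S)
      (((List.ofFn L).reverse.flatten).map ApproxStep.err).sum := by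
  have hgood : ∀ s ∈ (List.ofFn L).reverse.flatten, s.Good P := by
    intro s hs
    rw [List.mem_flatten] at hs
    obtain ⟨l, hl, hsl⟩ := hs
    rw [List.mem_reverse, List.mem_ofFn] at hl
    obtain ⟨i, rfl⟩ := hl
    have hideal : s.ideal ∈ allGates (S i) := by rw [← hL i]; exact List.mem_map_of_mem hsl
    exact ⟨himpl i s hsl, hcontr i s hsl, isContraction_of_mem_unitaryGroup (allGates_mem_unitaryGroup (S i) _ hideal),
      preservesSupp_allGates (S i) (hP i) _ hideal, herr i s hsl⟩
  have h := ImplOn.listProd hgood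
  have hid : (((List.ofFn L).reverse.flatten).map ApproxStep.ideal).prod = multiQFT S := by
    rw [List.map_flatten, List.map_reverse, List.map_ofFn, ← prod_flatten_allGates S]
    congr 3
    exact List.ofFn_inj.2 (funext fun i => hL i)
  rwa [hid] at h

end Literature.Computability.QuantumComplexity

end
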